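import Summits.QuantumFields.BalabanUV.Beta.GAN24.Entry110Rect
import Literature.MathematicalPhysics.QuantumFieldTheory.Balaban1983to89.B5G183FreeRowSum

/-!
# G-an2-4 ∕ T4 INTERFACE REQUEST NE7 #106 (lit-balaban `INTERFACES.md` §3 row IR-106): the SECOND entry «|∇GJ| ≤ O(1)|J|» of
# [B5] (1.115) for `G = Δ_1⁻¹ = (DeltaA n M 1)⁻¹` (`U = 1`, `a = 1`) IN THE COMPONENTWISE `sdiff` SPELLING asked by t4-ne7-p1 g70
# — a three-line re-spelling of `Entry110Rect.norm_fdiff_inv_mulVec_le` (leaf 02 gen 42, every torus, n-uniform), nothing new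

statement-level skeleton of published theorems with citation tags; proofs where landed; nothing here is a claim about the
Yang–Mills mass gap

WHY.  `t4/T4-DAG.md` v102 INTERFACE REQUEST #106 (pub-balaban∕INBOX.md L.51454, 2026-08-23T17:25Z; lit-balaban `INTERFACES.md` §3
row IR-106, OPEN at v1.53) asks BY NAME for
`norm_grad_DeltaA_one_inv_mulVec_le_global : ∀ (J : Tor (fine n M) × Fin (d+1) → ℂ) (B : ℝ), (∀ i, ‖J i‖ ≤ B) →
  ∀ (x : Tor (fine n M)) (μ ν : Fin (d+1)), ‖(sdiff (fine n M) (n : ℂ) ν *ᵥ (fun t => ((DeltaA n M 1)⁻¹ *ᵥ J) (t, μ))) x‖ ≤ C′ * B`,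
«constant uniform in `n = L^k` and the torus», the kernel input of NE7's brick 5 (slice solver letter G♭ at the flat background).
THE FACT IS ALREADY IN THE TREE: `Summit.QuantumFields.BalabanUV.Beta.GAN24.Entry110Rect.norm_fdiff_inv_mulVec_le` (2026-08-21) —
`∃ C > 0` depending on `d` only, EVERY `n ≥ 1`, EVERY torus `M`, every direction `ν`, every `J` with `|J| ≤ B`, every index
`i = (x, μ)`: `‖(fdiff (fine n M) n ν *ᵥ (Δ_1⁻¹ J)) i‖ ≤ C·B` (analysis: NE3's heat-kernel free gradient + resolvent identity via leaf 04's
`Entry110GradCubic`, pv15's block resummation, leaf 02's torus covering).  The vector-field difference `B5Prop11Plancherel.fdiff` and the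
scalar difference `B5Action121.sdiff` on one component agree pointwise (`B5G183FreeRowSum.fdiff_mulVec`, `B5Action121.sdiff_mulVec`:
both `= n·(u(x + e_ν, μ) − u(x, μ))`), which is all this file checks.

CONTENTS (0 `def`, 0 `def … : Prop`, 0 sorry; [folklore] bookkeeping).
* `sdiff_mulVec_component_eq_fdiff_mulVec` — `(sdiff N c ν *ᵥ (t ↦ u (t, μ))) x = (fdiff N c ν *ᵥ u) (x, μ)` on every torus `N`.
* **`norm_grad_DeltaA_one_inv_mulVec_le_global`** — THE REQUESTED NAME AND SPELLING: `∃ C > 0` (function of `d` only) with, for every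
  `n ≥ 1`, every torus `M : Fin (d+1) → ℕ`, every `J` with `|J| ≤ B`, every `x`, `μ`, `ν`:
  `‖(sdiff (fine n M) (n : ℂ) ν *ᵥ (fun t => ((DeltaA n M 1)⁻¹ *ᵥ J) (t, μ))) x‖ ≤ C * B`.
* `norm_grad_DeltaA_one_inv_mulVec_le_global_fixed` — the same at a fixed `(n, M)` after the constant is obtained once (consumer shape:
  `obtain ⟨C, hC, h⟩ := norm_grad_DeltaA_one_inv_mulVec_le_global (d := d)` and use `h n M J B hJ x μ ν` at every level `n = L^k`).

HONEST SCOPE.  `a = 1`, `U = 1`; the constant is GAN24's existential `C(d)` (no printed `O(1)` matched; no `N`-dependence — the pv15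
splitting order does not enter); sup norm (1.108) only — no Hölder entries (1.116)–(1.117), no (1.89).  Nothing printed is asserted:
[B5] `Balaban1984PropagatorsI` p. 36 (1.115) «|GJ|, |∇GJ|, |G∇*J|, |ΔGJ|, ‖∇GJ‖_α, ‖G∇*J‖_α ≤ O(1)|J|» is a TEXT LOCATION.  NOT NE7,
NOT (APE), NOT NE3, NOT D1, NOT BetaPertH, NOT continuum, NOT Clay — a re-spelling of a landed GAN24 theorem for a named consumer.
HONEST DEPENDENCY: continuum YM on T⁴ ⇐ BetaPertH ∧ nine spine estimates (0/9 proved); BetaPertH ⇐ (D1) ∧ (D4) ∧ CAP+tail; G-an2-4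
gates asym, D1 and NE2/3/4.  Filed by lit-balaban r01 gen 47 (B4 = [Balaban1983RegularityDecay] fold owner; lattice Green's function
regularity lane) answering IR-106 as a free-target pointer; ABSOLUTE RULE kept (every input a kernel-proved tree theorem BY NAME).
-/

noncomputable section

open scoped BigOperators Matrix
open Finset

namespace Summit.QuantumFields.BalabanUV.Beta.GAN24.Entry115SupSdiff

open Literature.MathematicalPhysics.QuantumFieldTheory.Balaban1983to89
open B5Prop11Plancherel (Tor fine fdiff unitVec)
open B5Action121 (sdiff sdiff_mulVec)
open B5DeltaA169 (DeltaA)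
open B5G183FreeRowSum (fdiff_mulVec)

variable {d : ℕ}

/-- **componentwise spelling**: the scalar forward difference `sdiff` of the `μ`-component of a vector field at `x` IS the vector-field
forward difference `fdiff` at the index `(x, μ)` — both equal `c·(u(x + e_ν, μ) − u(x, μ))`. [folklore] -/
theorem sdiff_mulVec_component_eq_fdiff_mulVec (N : Fin d → ℕ) [∀ μ, NeZero (N μ)] (c : ℂ) (ν : Fin d)
    (u : Tor N × Fin d → ℂ) (x : Tor N) (μ : Fin d) :
    (sdiff N c ν *ᵥ fun t => u (t, μ)) x = (fdiff N c ν *ᵥ u) (x, μ) := by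
  rw [sdiff_mulVec, fdiff_mulVec]

/-- **[B5] (1.115), SECOND ENTRY «|∇GJ| ≤ O(1)|J|» FOR `G = Δ_1⁻¹`, IN THE SPELLING OF T4 INTERFACE REQUEST NE7 #106** (lit-balaban
IR-106): there is `C > 0` depending on `d` only such that for EVERY spacing `n ≥ 1`, EVERY torus `M`, every source `J` with `|J| ≤ B`
(sup norm (1.108)), every site `x` and directions `μ`, `ν`:
`‖(∇_ν (Δ_1⁻¹ J)_μ)(x)‖ = ‖(sdiff (fine n M) n ν *ᵥ (t ↦ (Δ_1⁻¹ J)(t, μ))) x‖ ≤ C·B` — uniform in `n = L^k` and in the torus.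
This is `Entry110Rect.norm_fdiff_inv_mulVec_le` BY NAME, re-indexed by `sdiff_mulVec_component_eq_fdiff_mulVec`.
(Text location: [B5] `Balaban1984PropagatorsI` p. 36, (1.115); the typed inequality is not a quotation.) [folklore] -/
theorem norm_grad_DeltaA_one_inv_mulVec_le_global :
    ∃ C : ℝ, 0 < C ∧ ∀ (n : ℕ) (M : Fin (d + 1) → ℕ) [NeZero n] [∀ μ, NeZero (M μ)]
      (J : Tor (fine n M) × Fin (d + 1) → ℂ) (B : ℝ), (∀ i, ‖J i‖ ≤ B) →
        ∀ (x : Tor (fine n M)) (μ ν : Fin (d + 1)),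
          ‖(sdiff (fine n M) (n : ℂ) ν *ᵥ (fun t => ((DeltaA n M 1)⁻¹ *ᵥ J) (t, μ))) x‖ ≤ C * B := by
  obtain ⟨C, hC, h⟩ := Entry110Rect.norm_fdiff_inv_mulVec_le (d := d)
  refine ⟨C, hC, fun n M _ _ J B hJB x μ ν => ?_⟩
  rw [sdiff_mulVec_component_eq_fdiff_mulVec]
  exact h n M ν J B hJB (x, μ)

/-- **the same at a fixed spacing and torus**, consumer shape: once `C` is obtained from `norm_grad_DeltaA_one_inv_mulVec_le_global`, the
bound holds verbatim in the requested form `∀ J B, (∀ i, ‖J i‖ ≤ B) → ∀ x μ ν, ‖…‖ ≤ C * B` at every `(n, M)`. [folklore] -/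
theorem norm_grad_DeltaA_one_inv_mulVec_le_global_fixed (n : ℕ) (M : Fin (d + 1) → ℕ) [NeZero n] [∀ μ, NeZero (M μ)] :
    ∃ C : ℝ, 0 < C ∧ ∀ (J : Tor (fine n M) × Fin (d + 1) → ℂ) (B : ℝ), (∀ i, ‖J i‖ ≤ B) →
      ∀ (x : Tor (fine n M)) (μ ν : Fin (d + 1)),
        ‖(sdiff (fine n M) (n : ℂ) ν *ᵥ (fun t => ((DeltaA n M 1)⁻¹ *ᵥ J) (t, μ))) x‖ ≤ C * B := by
  obtain ⟨C, hC, h⟩ := norm_grad_DeltaA_one_inv_mulVec_le_global (d := d)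
  exact ⟨C, hC, fun J B hJB x μ ν => h n M J B hJB x μ ν⟩

end Summit.QuantumFields.BalabanUV.Beta.GAN24.Entry115SupSdiff

end
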